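import Mathlib.Analysis.Calculus.MeanValue
import Mathlib.Analysis.SpecialFunctions.ExpDeriv
import Mathlib.MeasureTheory.Integral.IntervalIntegral.FundThmCalculus
import Mathlib.Order.Interval.Set.ProjIcc
import Mathlib.Topology.Order.ProjIcc
import HarnessLib

/-!
# Linear comparison (variable-coefficient Grönwall) and the continuity/bootstrap lemma

Two folklore tools of ODE bootstrap arguments, in the form used e.g. throughout §6 of
T. Tao, *Finite time blowup for an averaged three-dimensional Navier–Stokes equation*
(J. Amer. Math. Soc. 29 (2016)), "by Gronwall's inequality" / "by a continuity argument":

* `le_linearComparison` / `linearComparison_le`: if `g` is continuous on `[a, b]` with right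
  derivative `g'` on `[a, b)` and `g' ≤ A + β g` there (`A, β` continuous on `[a, b]`), then
  `g(t) ≤ e^{B(t)} (g(a) + ∫_a^t A(s) e^{-B(s)} ds)` with `B(t) = ∫_a^t β`; the reverse inequality
  for `g' ≥ A + β g`; and the two-sided corollary `abs_le_linearComparison`:
  `|g(t)| ≤ e^{∫_a^t |β|} (|g(a)| + ∫_a^t R)` when `|g' - β g| ≤ R`;
* corollaries without exponential factor (`le_add_integral_of_deriv_right_le`,
  `add_integral_le_of_le_deriv_right`) and the glue from "`C¹` on a half-line `[τ₀, +∞)`"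
  (`ContDiffOn ℝ 1 g (Ici τ₀)`, one-sided `derivWithin`) to these hypotheses.

The continuity ("bootstrap") companion is `Literature/Analysis/ODE/MaximalTime.lean`
(`maximalTimeP`). Mathlib has the constant-coefficient Grönwall bound
(`Mathlib.Analysis.ODE.Gronwall`) and the fencing theorem
`image_le_of_deriv_right_le_deriv_boundary`, from which the variable-coefficient statement is
derived here via the integrating factor `e^{-B(t)}`; coefficients continuous on `[a, b]` are
extended to `ℝ` with Mathlib's `Set.IccExtend` to use the FTC at interior and boundary points
uniformly. The hypothesis `a ≤ b` is read off from `t ∈ [a, b]` where a time `t` is present.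

## References

* P. Hartman, *Ordinary Differential Equations*, 2nd ed., SIAM 2002, Ch. III §1 (Grönwall's
  inequality, Thm. 1.1); the variable-coefficient form is folklore.
-/

noncomputable section

open Set MeasureTheory intervalIntegral Filter Topology

namespace Literature.Analysis.ODE

/-! ## Extending coefficients continuous on `[a, b]` to `ℝ` (Mathlib's `Set.IccExtend`) -/

/-- The continuous extension `IccExtend` of a function continuous on `[a, b]` (constant outside).
[folklore] -/
theorem continuous_IccExtend_restrict {a b : ℝ} (hab : a ≤ b) {f : ℝ → ℝ}
    (hf : ContinuousOn f (Icc a b)) : Continuous (IccExtend hab ((Icc a b).restrict f)) :=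
  (continuousOn_iff_continuous_restrict.mp hf).Icc_extend'

/-- On `[a, b]` the extension agrees with the function. [folklore] -/
theorem IccExtend_restrict_of_mem {a b : ℝ} (hab : a ≤ b) {f : ℝ → ℝ} {x : ℝ}
    (hx : x ∈ Icc a b) : IccExtend hab ((Icc a b).restrict f) x = f x := by
  rw [IccExtend_of_mem _ _ hx]; rfl

/-! ## The integrating factor -/

/-- The primitive `B(t) = ∫_a^t β` of a function continuous on `[a, b]` has right derivative
`β(t)` at every `t ∈ [a, b)` (computed through the globally continuous extension of `β`).
[folklore] -/
theorem hasDerivWithinAt_primitive {a b : ℝ} (hab : a ≤ b) {β : ℝ → ℝ}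
    (hβ : ContinuousOn β (Icc a b)) {t : ℝ} (ht : t ∈ Ico a b) :
    HasDerivWithinAt (fun u => ∫ s in a..u, IccExtend hab ((Icc a b).restrict β) s) (β t)
      (Ici t) t := by
  have hc := continuous_IccExtend_restrict hab hβ
  have h := integral_hasStrictDerivAt_right (hc.intervalIntegrable a t)
    (hc.stronglyMeasurableAtFilter volume (𝓝 t)) hc.continuousAt
  rw [IccExtend_restrict_of_mem hab (Ico_subset_Icc_self ht)] at h
  exact h.hasDerivAt.hasDerivWithinAt

/-- On `[a, b]` the primitive of the extension is the primitive: for `t ∈ [a, b]`,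
`∫_a^t (IccExtend β) = ∫_a^t β`. [folklore] -/
theorem primitive_IccExtend_eq {a b : ℝ} (hab : a ≤ b) {β : ℝ → ℝ} {t : ℝ} (ht : t ∈ Icc a b) :
    ∫ s in a..t, IccExtend hab ((Icc a b).restrict β) s = ∫ s in a..t, β s := by
  apply integral_congr
  intro s hs
  rw [uIcc_of_le ht.1] at hs
  exact IccExtend_restrict_of_mem hab ⟨hs.1, hs.2.trans ht.2⟩

/-! ## Linear comparison -/

/-- **Linear comparison, upper bound (variable-coefficient Grönwall).** Let `g` be
continuous on `[a, b]` with right derivative `g'(t)` at every `t ∈ [a, b)`, let `A, β` be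
continuous on `[a, b]`, and suppose `g' ≤ A + β g` on `[a, b)`. Then for `t ∈ [a, b]`,
`g(t) ≤ e^{B(t)} (g(a) + ∫_a^t A(s) e^{-B(s)} ds)` where `B(t) = ∫_a^t β`. [folklore] -/
theorem le_linearComparison {a b : ℝ} {g g' A β : ℝ → ℝ}
    (hg : ContinuousOn g (Icc a b)) (hg' : ∀ t ∈ Ico a b, HasDerivWithinAt g (g' t) (Ici t) t)
    (hA : ContinuousOn A (Icc a b)) (hβ : ContinuousOn β (Icc a b))
    (bound : ∀ t ∈ Ico a b, g' t ≤ A t + β t * g t) {t : ℝ} (ht : t ∈ Icc a b) :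
    g t ≤ Real.exp (∫ s in a..t, β s) *
      (g a + ∫ s in a..t, A s * Real.exp (-(∫ u in a..s, β u))) := by
  -- clamped copies, continuous on `ℝ`
  have hab : a ≤ b := ht.1.trans ht.2
  set βc : ℝ → ℝ := IccExtend hab ((Icc a b).restrict β) with hβc
  set Ac : ℝ → ℝ := IccExtend hab ((Icc a b).restrict A) with hAc
  have hβcc : Continuous βc := continuous_IccExtend_restrict hab hβ
  have hAcc : Continuous Ac := continuous_IccExtend_restrict hab hA
  set Bf : ℝ → ℝ := fun u => ∫ s in a..u, βc s with hBf
  have hBfc : Continuous Bf := by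
    simpa [hBf] using (continuous_primitive hβcc.intervalIntegrable a)
  have hBf' : ∀ u ∈ Ico a b, HasDerivWithinAt Bf (β u) (Ici u) u := fun u hu =>
    hasDerivWithinAt_primitive hab hβ hu
  -- `F = g e^{-Bf}`, `G = g a + ∫ A e^{-Bf}`
  set F : ℝ → ℝ := fun u => g u * Real.exp (-Bf u) with hF
  set h : ℝ → ℝ := fun s => Ac s * Real.exp (-Bf s) with hh
  have hhc : Continuous h := hAcc.mul (hBfc.neg.rexp)
  set G : ℝ → ℝ := fun u => g a + ∫ s in a..u, h s with hG
  have hFc : ContinuousOn F (Icc a b) := hg.mul (hBfc.neg.rexp).continuousOn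
  have hGc : ContinuousOn G (Icc a b) :=
    (continuous_const.add (continuous_primitive hhc.intervalIntegrable a)).continuousOn
  have hF' : ∀ u ∈ Ico a b, HasDerivWithinAt F
      (g' u * Real.exp (-Bf u) + g u * (Real.exp (-Bf u) * -β u)) (Ici u) u := by
    intro u hu
    exact (hg' u hu).mul ((hBf' u hu).neg.exp)
  have hG' : ∀ u ∈ Ico a b, HasDerivWithinAt G (h u) (Ici u) u := by
    intro u hu
    have := integral_hasStrictDerivAt_right (hhc.intervalIntegrable a u)
      (hhc.stronglyMeasurableAtFilter volume (𝓝 u)) hhc.continuousAt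
    exact (this.hasDerivAt.hasDerivWithinAt).const_add (g a)
  have hFa : F a ≤ G a := by
    simp [hF, hG, hBf]
  have hbound : ∀ u ∈ Ico a b,
      g' u * Real.exp (-Bf u) + g u * (Real.exp (-Bf u) * -β u) ≤ h u := by
    intro u hu
    have hexp : 0 < Real.exp (-Bf u) := Real.exp_pos _
    have hb := bound u hu
    have hAu : Ac u = A u := IccExtend_restrict_of_mem hab (Ico_subset_Icc_self hu)
    rw [hh]; dsimp only; rw [hAu]
    nlinarith [mul_le_mul_of_nonneg_right hb hexp.le]
  have hFG := image_le_of_deriv_right_le_deriv_boundary hFc hF' hFa hGc hG' hbound ht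
  -- unpack
  have hexp : 0 < Real.exp (Bf t) := Real.exp_pos _
  have hBt : Bf t = ∫ s in a..t, β s := primitive_IccExtend_eq hab ht
  have hint : ∫ s in a..t, h s = ∫ s in a..t, A s * Real.exp (-(∫ u in a..s, β u)) := by
    apply integral_congr
    intro s hs
    rw [uIcc_of_le ht.1] at hs
    have hs' : s ∈ Icc a b := ⟨hs.1, hs.2.trans ht.2⟩
    simp only [hh, hAc, hBf]
    rw [IccExtend_restrict_of_mem hab hs', primitive_IccExtend_eq hab hs']
  have key : g t = Real.exp (Bf t) * F t := by
    simp only [hF]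
    rw [mul_comm (g t), ← mul_assoc, ← Real.exp_add, add_neg_cancel, Real.exp_zero, one_mul]
  rw [key, ← hBt, ← hint]
  exact mul_le_mul_of_nonneg_left hFG hexp.le

/-- **Linear comparison, lower bound.** Under the hypotheses of `le_linearComparison` but with
`g' ≥ A + β g` on `[a, b)`, one has `g(t) ≥ e^{B(t)} (g(a) + ∫_a^t A(s) e^{-B(s)} ds)`.
[folklore] -/
theorem linearComparison_le {a b : ℝ} {g g' A β : ℝ → ℝ}
    (hg : ContinuousOn g (Icc a b)) (hg' : ∀ t ∈ Ico a b, HasDerivWithinAt g (g' t) (Ici t) t)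
    (hA : ContinuousOn A (Icc a b)) (hβ : ContinuousOn β (Icc a b))
    (bound : ∀ t ∈ Ico a b, A t + β t * g t ≤ g' t) {t : ℝ} (ht : t ∈ Icc a b) :
    Real.exp (∫ s in a..t, β s) *
      (g a + ∫ s in a..t, A s * Real.exp (-(∫ u in a..s, β u))) ≤ g t := by
  have h := le_linearComparison (g := fun u => -g u) (g' := fun u => -g' u)
    (A := fun u => -A u) hg.neg (fun u hu => (hg' u hu).neg) hA.neg hβ
    (fun u hu => by have := bound u hu; nlinarith) ht
  have hint : ∫ s in a..t, -A s * Real.exp (-(∫ u in a..s, β u)) =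
      -∫ s in a..t, A s * Real.exp (-(∫ u in a..s, β u)) := by
    rw [← intervalIntegral.integral_neg]; congr 1; ext s; ring
  rw [hint] at h
  nlinarith [h, Real.exp_pos (∫ s in a..t, β s)]

/-- Exponentials of primitives are controlled by the primitive of the absolute value:
`e^{B(t) - B(s)} ≤ e^{∫_a^t |β|}` for `a ≤ s ≤ t ≤ b`. [folklore] -/
theorem exp_primitive_sub_le {a b : ℝ} {β : ℝ → ℝ} (hβ : ContinuousOn β (Icc a b)) {s t : ℝ}
    (hs : s ∈ Icc a t) (ht : t ≤ b) :
    Real.exp ((∫ u in a..t, β u) - ∫ u in a..s, β u) ≤ Real.exp (∫ u in a..t, |β u|) := by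
  apply Real.exp_le_exp.mpr
  have hst : s ≤ t := hs.2
  have hβi : ∀ {x y : ℝ}, a ≤ x → x ≤ y → y ≤ b → IntervalIntegrable β volume x y :=
    fun hx hxy hy => (hβ.mono (Icc_subset_Icc hx hy)).intervalIntegrable_of_Icc hxy
  have hβai : ∀ {x y : ℝ}, a ≤ x → x ≤ y → y ≤ b → IntervalIntegrable (fun u => |β u|) volume x y :=
    fun hx hxy hy => (hβ.abs.mono (Icc_subset_Icc hx hy)).intervalIntegrable_of_Icc hxy
  rw [integral_interval_sub_left (hβi le_rfl (hs.1.trans hst) ht) (hβi le_rfl hs.1 (hst.trans ht))]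
  calc ∫ u in s..t, β u ≤ ∫ u in s..t, |β u| :=
        integral_mono_on hst (hβi hs.1 hst ht) (hβai hs.1 hst ht) fun u _ => le_abs_self _
    _ ≤ ∫ u in a..t, |β u| := by
        rw [← integral_add_adjacent_intervals (hβai le_rfl hs.1 (hst.trans ht)) (hβai hs.1 hst ht)]
        have : 0 ≤ ∫ u in a..s, |β u| := integral_nonneg hs.1 fun u _ => abs_nonneg _
        linarith

/-- **Two-sided linear comparison.** Let `g` be continuous on `[a, b]` with right derivative
`g'` on `[a, b)`, `β, R` continuous on `[a, b]` with `R ≥ 0`, and `|g'(t) - β(t) g(t)| ≤ R(t)` on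
`[a, b)`. Then `|g(t)| ≤ e^{∫_a^t |β|} (|g(a)| + ∫_a^t R)` for `t ∈ [a, b]`. [folklore] -/
theorem abs_le_linearComparison {a b : ℝ} {g g' R β : ℝ → ℝ}
    (hg : ContinuousOn g (Icc a b)) (hg' : ∀ t ∈ Ico a b, HasDerivWithinAt g (g' t) (Ici t) t)
    (hR : ContinuousOn R (Icc a b)) (hR0 : ∀ t ∈ Icc a b, 0 ≤ R t) (hβ : ContinuousOn β (Icc a b))
    (bound : ∀ t ∈ Ico a b, |g' t - β t * g t| ≤ R t) {t : ℝ} (ht : t ∈ Icc a b) :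
    |g t| ≤ Real.exp (∫ s in a..t, |β s|) * (|g a| + ∫ s in a..t, R s) := by
  have hab : a ≤ b := ht.1.trans ht.2
  have hup := le_linearComparison hg hg' hR hβ
    (fun u hu => by have := (abs_le.mp (bound u hu)).2; linarith) ht
  have hlo := linearComparison_le hg hg' hR.neg hβ
    (fun u hu => by have := (abs_le.mp (bound u hu)).1; simp only [Pi.neg_apply]; linarith) ht
  set B : ℝ → ℝ := fun s => ∫ u in a..s, β u with hB
  set M : ℝ := Real.exp (∫ u in a..t, |β u|) with hM
  have hE : 0 < Real.exp (B t) := Real.exp_pos _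
  have hEabs : ∀ s ∈ Icc a t, Real.exp (B t) * Real.exp (-B s) ≤ M := by
    intro s hs
    rw [← Real.exp_add, ← sub_eq_add_neg]
    exact exp_primitive_sub_le hβ hs ht.2
  have hEt : Real.exp (B t) ≤ M := by
    have := hEabs a ⟨le_rfl, ht.1⟩
    simpa [hB] using this
  have hBc : ContinuousOn B (Icc a b) := by
    have : ∀ s ∈ Icc a b, B s = ∫ u in a..s, IccExtend hab ((Icc a b).restrict β) u :=
      fun s hs => (primitive_IccExtend_eq hab hs).symm
    refine ContinuousOn.congr ?_ this
    exact (continuous_primitive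
      ((continuous_IccExtend_restrict hab hβ).intervalIntegrable) a).continuousOn
  have hRt : ContinuousOn R (Icc a t) := hR.mono (Icc_subset_Icc le_rfl ht.2)
  have hRi : IntervalIntegrable R volume a t := hRt.intervalIntegrable_of_Icc ht.1
  have hwc : ContinuousOn (fun s => R s * Real.exp (-B s)) (Icc a t) :=
    hRt.mul ((hBc.mono (Icc_subset_Icc le_rfl ht.2)).neg.rexp)
  have hwi : IntervalIntegrable (fun s => R s * Real.exp (-B s)) volume a t :=
    hwc.intervalIntegrable_of_Icc ht.1
  -- the weighted integral against `e^{B t}` is at most `M ∫ R`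
  have hint : Real.exp (B t) * ∫ s in a..t, R s * Real.exp (-B s) ≤ M * ∫ s in a..t, R s := by
    rw [← intervalIntegral.integral_const_mul, ← intervalIntegral.integral_const_mul]
    apply integral_mono_on ht.1 (hwi.const_mul _) (hRi.const_mul _)
    intro s hs
    have hRs := hR0 s ⟨hs.1, hs.2.trans ht.2⟩
    calc Real.exp (B t) * (R s * Real.exp (-B s)) = (Real.exp (B t) * Real.exp (-B s)) * R s := by
          ring
      _ ≤ M * R s := mul_le_mul_of_nonneg_right (hEabs s hs) hRs
  have hint0 : 0 ≤ ∫ s in a..t, R s :=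
    integral_nonneg ht.1 fun s hs => hR0 s ⟨hs.1, hs.2.trans ht.2⟩
  have hga : Real.exp (B t) * g a ≤ M * |g a| :=
    calc Real.exp (B t) * g a ≤ Real.exp (B t) * |g a| :=
          mul_le_mul_of_nonneg_left (le_abs_self _) hE.le
      _ ≤ M * |g a| := mul_le_mul_of_nonneg_right hEt (abs_nonneg _)
  have hga' : -(M * |g a|) ≤ Real.exp (B t) * g a := by
    have h1 : Real.exp (B t) * -|g a| ≤ Real.exp (B t) * g a :=
      mul_le_mul_of_nonneg_left (neg_abs_le _) hE.le
    have h2 : Real.exp (B t) * |g a| ≤ M * |g a| := mul_le_mul_of_nonneg_right hEt (abs_nonneg _)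
    linarith
  have hneg : ∫ s in a..t, -R s * Real.exp (-(∫ u in a..s, β u)) =
      -∫ s in a..t, R s * Real.exp (-B s) := by
    rw [← intervalIntegral.integral_neg]; congr 1; ext s; simp [hB]
  rw [abs_le]
  constructor
  · -- lower bound
    have h1 : Real.exp (B t) * (g a + ∫ s in a..t, -R s * Real.exp (-(∫ u in a..s, β u))) ≤ g t :=
      hlo
    rw [hneg, mul_add, mul_neg] at h1
    linarith
  · have h1 : g t ≤ Real.exp (B t) * (g a + ∫ s in a..t, R s * Real.exp (-(∫ u in a..s, β u))) :=
      hup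
    rw [mul_add] at h1
    linarith

/-! ## Corollaries without the exponential factor -/

/-- **Integrating a one-sided differential inequality.** If `g' ≤ A` on `[a, b)` (hypotheses as
in `le_linearComparison` with `β = 0`), then `g(t) ≤ g(a) + ∫_a^t A`. [folklore] -/
theorem le_add_integral_of_deriv_right_le {a b : ℝ} {g g' A : ℝ → ℝ}
    (hg : ContinuousOn g (Icc a b)) (hg' : ∀ t ∈ Ico a b, HasDerivWithinAt g (g' t) (Ici t) t)
    (hA : ContinuousOn A (Icc a b)) (bound : ∀ t ∈ Ico a b, g' t ≤ A t) {t : ℝ}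
    (ht : t ∈ Icc a b) : g t ≤ g a + ∫ s in a..t, A s := by
  have h := le_linearComparison hg hg' hA continuousOn_const (β := fun _ => 0)
    (fun u hu => by simpa using bound u hu) ht
  simpa using h

/-- **Integrating a one-sided differential inequality, lower version.** If `A ≤ g'` on `[a, b)`
then `g(a) + ∫_a^t A ≤ g(t)`. [folklore] -/
theorem add_integral_le_of_le_deriv_right {a b : ℝ} {g g' A : ℝ → ℝ}
    (hg : ContinuousOn g (Icc a b)) (hg' : ∀ t ∈ Ico a b, HasDerivWithinAt g (g' t) (Ici t) t)
    (hA : ContinuousOn A (Icc a b)) (bound : ∀ t ∈ Ico a b, A t ≤ g' t) {t : ℝ}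
    (ht : t ∈ Icc a b) : g a + ∫ s in a..t, A s ≤ g t := by
  have h := linearComparison_le hg hg' hA continuousOn_const (β := fun _ => 0)
    (fun u hu => by simpa using bound u hu) ht
  simpa using h

/-! ## From `C¹` on a half-line to the hypotheses above -/

/-- A function `C¹` on `[τ₀, +∞)` has, at every `t ≥ τ₀`, the right derivative
`derivWithin g (Ici τ₀) t` within `[t, +∞)`. [folklore] -/
theorem hasDerivWithinAt_Ici_of_contDiffOn {g : ℝ → ℝ} {τ₀ : ℝ} (hg : ContDiffOn ℝ 1 g (Ici τ₀))
    {t : ℝ} (ht : τ₀ ≤ t) : HasDerivWithinAt g (derivWithin g (Ici τ₀) t) (Ici t) t :=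
  ((hg.differentiableOn_one t ht).hasDerivWithinAt).mono (Ici_subset_Ici.mpr ht)

/-- A function `C¹` on `[τ₀, +∞)` is continuous on every `[a, b]` with `τ₀ ≤ a`. [folklore] -/
theorem continuousOn_Icc_of_contDiffOn {g : ℝ → ℝ} {τ₀ a b : ℝ} (hg : ContDiffOn ℝ 1 g (Ici τ₀))
    (ha : τ₀ ≤ a) : ContinuousOn g (Icc a b) :=
  hg.continuousOn.mono fun _ hx => ha.trans hx.1

/-- The one-sided derivative of a function `C¹` on `[τ₀, +∞)` is continuous on every `[a, b]`
with `τ₀ ≤ a`. [folklore] -/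
theorem continuousOn_derivWithin_Icc_of_contDiffOn {g : ℝ → ℝ} {τ₀ a b : ℝ}
    (hg : ContDiffOn ℝ 1 g (Ici τ₀)) (ha : τ₀ ≤ a) :
    ContinuousOn (derivWithin g (Ici τ₀)) (Icc a b) :=
  (hg.continuousOn_derivWithin (uniqueDiffOn_Ici τ₀) le_rfl).mono fun _ hx => ha.trans hx.1

/-- **Fundamental theorem of calculus on a half-line**: for `g` of class `C¹` on `[τ₀, +∞)` and
`τ₀ ≤ a ≤ t`, `g(t) - g(a) = ∫_a^t g′` with `g′ = derivWithin g (Ici τ₀)`. [folklore] -/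
theorem integral_derivWithin_Ici_eq_sub {g : ℝ → ℝ} {τ₀ a t : ℝ} (hg : ContDiffOn ℝ 1 g (Ici τ₀))
    (ha : τ₀ ≤ a) (hat : a ≤ t) :
    ∫ s in a..t, derivWithin g (Ici τ₀) s = g t - g a := by
  apply integral_eq_sub_of_hasDeriv_right_of_le hat (continuousOn_Icc_of_contDiffOn hg ha)
  · intro s hs
    exact (hasDerivWithinAt_Ici_of_contDiffOn hg (ha.trans hs.1.le)).mono Ioi_subset_Ici_self
  · exact (continuousOn_derivWithin_Icc_of_contDiffOn hg ha).intervalIntegrable_of_Icc hat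

end Literature.Analysis.ODE
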